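import Literature.Probability.Percolation.KhSThreeDisorderNormalisation
import HarnessLib

/-!
# Khristoforov–Smirnov eq. (4) at `k = 3`, loop side: on the boundary arc `A₀` the link pattern `[z ↔ u₂]` is absent (`H₂(z) = 0`)

Topic `Literature/Probability/Percolation`; lane pcv-sawmu (CriticalPhenomena), three-disorder lineage (after `KhSThreeDisorderObservable`,
`…Contour`, `…Normalisation`). Khristoforov–Smirnov, §2 p. 5 («In terms of observable F Lemma 2 says that if mid-edges u₁, u₂, u₃ lie on the
boundary of Ω and a mid-edge z lies on the boundary arc ∂_jΩ then F(z) = P[…]·τ^{j−1} + P[…]·τ^{j+1} ⊂ [τ^{j−1}, τ^{j+1}]», eq. (4)):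
on the arc not containing `u_j` the pattern `[z ↔ u_j]` does not occur. This file proves the LOOP-SIDE half for the arc `A₀` of a
3-marked discrete domain (the stretch from the mark `0` to the mark `1`, opposite to the corner `y₂`), in the vocabulary of the parent
files: for a boundary bond `side v i = s(g, o)` whose dart `(g, o)` has stretch index `0`, read at a face `v` with three `H_G`-sides,

* `not_reachable_yc_two` (generic case, the endpoint `s ∈ {v, oppFace v i}` not a corner face): in no configuration of the XOR space
  `TXb D v i s` is `s` linked to `y₂`. Proof = COLOUR PROPAGATION, no crossing duality: delete the strand of `s`
  (`restrict_off_component`), the rest has odd faces `{y₀, y₁}` (`odd_component`: the strand's other odd end is `y₂`) and is the loop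
  configuration of a colouring with the frame `A₀` (`xiOf₃_surj`); the faces of the strand have no side in it, so all their `G`-sites carry
  one colour — BLACK, read at `y₂` across its two non-bicoloured `H_G`-sides from the arcs `A₁`, `A₂`; but the `G`-endpoint `g` of `z`
  reads WHITE across the non-bicoloured bond `s(g, o)` from `A₀`. (The text of `hc3K_black` of the parent file, re-run on the XOR space.)
* `not_reachable_of_corner_end` («z adjacent to a mark»: an endpoint that is itself a corner face is isolated in the configuration),
  `ne_yc_two_of_stretch_zero` (`y₂` is not a face of an `A₀`-edge), `xiDeg_le_two_of_mem_TXb` (side counts ≤ 2 on `TXb`);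
* ★ `classCount_two_eq_zero_of_stretch_zero` (**`N₂(z) = 0`**), `hobs_two_eq_zero_of_stretch_zero` (**`H₂(z) = 0`**), and with the
  normalisation `sum_hobs_eq_one`: `hobs_zero_add_hobs_one_of_stretch_zero` (`H₀ + H₁ = 1`) and `fobs_of_stretch_zero`
  (**`F(z) = H₀(z) + τ·H₁(z)`**, a point of the segment `[1, τ]` — the Riemann–Hilbert boundary condition on `A₀`).

Scope: printed for every boundary arc; formalised for the arc `A₀` (the frame of `TriIface3` / `xiOf₃` changes colour at the marks `0`
and `1`); the arcs `A₁`, `A₂` follow by the cyclic symmetry of the marks (`TriMarkedDomain.rotate`, banked `TriMarkedDomainRotate.lean`)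
— TODO(general form). LOOP SIDE ONLY: the PERCOLATION-side identification of `H₀`, `H₁` with crossing probabilities (Lemma 2 with
four disorders), the full boundary-value problem of eq. (4) for `F` and its uniqueness (§3) are NOT claimed here.

## References
* M. Khristoforov, S. Smirnov, *Percolation and O(1) loop model*, arXiv:2111.15612 (2021), §1.2 (pp. 2–3), §2 Definition 3 (p. 4), eq. (4)
  (p. 5) — arXiv v1 pages.
-/


open Finset

namespace Literature.Probability.Percolation.MarkedLoops

open Literature.Probability.Percolation Literature.Probability.LatticeModels
open Literature.Probability.Percolation.FivePoint (side side_injective xiDeg XiLinked tau)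
open Literature.Probability.Percolation.FivePoint.N5 (sideGraph side_oppFace_oppIdx l1_xiDeg_eq xiLinked_iff_reachable h1_ne_oppFace
  ht3_pair_eq_side)
open TriMarkedDomain

section Blocks

variable {nm : ℕ} (D : TriMarkedDomain nm)

/-- a corner face has at most two sides in any edge set of `H_G`. [cite: KhristoforovSmirnov2021, §1.2 (loop configurations, arXiv v1 pp. 2–3)] -/
theorem xiDeg_corner_le_two {ξ : Finset (Sym2 (Site 2))} (hξ : ξ ⊆ hBonds D) {j : Fin nm} {F : HexVertex}
    (hF : IsCornerFace D j F) : xiDeg ξ F ≤ 2 := by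
  classical
  obtain ⟨w, hw⟩ := exists_side_not_mem_hBonds_of_corner D hF
  rw [l1_xiDeg_eq]
  have hsub : ((Finset.univ : Finset (Fin 3)).filter fun j' => side F j' ∈ ξ) ⊆ Finset.univ.erase w := by
    intro j' hj'
    rw [Finset.mem_filter] at hj'
    rw [Finset.mem_erase]
    exact ⟨fun e => hw (e ▸ hξ hj'.2), Finset.mem_univ _⟩
  have hcard : #((Finset.univ : Finset (Fin 3)).erase w) = 2 := by
    rw [Finset.card_erase_of_mem (Finset.mem_univ w), Finset.card_univ, Fintype.card_fin]
  exact (Finset.card_le_card hsub).trans hcard.le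

/-- ★ **every face has at most two sides in a configuration of the XOR space `TXb`** (so its side graph is a disjoint union of paths and
cycles): a face with three sides in `ξ` would be odd, hence a corner (which has a non-`H_G` side) or the endpoint `s ∈ {v, oppFace v i}`
(which misses the bond `side v i`). [cite: KhristoforovSmirnov2021, §1.2 (loop configurations, arXiv v1 pp. 2–3)] -/
theorem xiDeg_le_two_of_mem_TXb {v : HexVertex} (i : Fin 3) {s : HexVertex} (hs : s ∈ ({v, oppFace v i} : Finset HexVertex))
    {ξ : Finset (Sym2 (Site 2))} (hξ : ξ ∈ TXb D v i s) (F : HexVertex) : xiDeg ξ F ≤ 2 := by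
  classical
  rw [mem_TXb_iff] at hξ
  obtain ⟨hsub, hpar⟩ := hξ
  have hξh : ξ ⊆ hBonds D := fun b hb => Finset.mem_of_mem_erase (hsub hb)
  by_contra hlt
  rw [not_le, l1_xiDeg_eq] at hlt
  -- all three sides lie in ξ
  have hall : ∀ j : Fin 3, side F j ∈ ξ := by
    have hle : #((Finset.univ : Finset (Fin 3)).filter fun j => side F j ∈ ξ) ≤ 3 :=
      (Finset.card_filter_le _ _).trans (by rw [Finset.card_univ, Fintype.card_fin])
    have heq : ((Finset.univ : Finset (Fin 3)).filter fun j => side F j ∈ ξ) = Finset.univ :=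
      Finset.eq_univ_of_card _ (by rw [Fintype.card_fin]; omega)
    intro j
    have := Finset.mem_univ j
    rw [← heq, Finset.mem_filter] at this
    exact this.2
  have hFt : F ∈ triFacesTouching D.verts := mem_touching_of_side_mem D (hξh (hall 0))
  have hodd : Odd (xiDeg ξ F) := by
    rw [l1_xiDeg_eq, Finset.filter_true_of_mem fun j _ => hall j, Finset.card_univ, Fintype.card_fin]
    decide
  have hmem := (hpar F hFt).1 hodd
  rw [Finset.mem_symmDiff, Finset.mem_singleton] at hmem
  rcases hmem with ⟨hc, -⟩ | ⟨rfl, -⟩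
  · obtain ⟨j, rfl⟩ := (mem_corners D).1 hc
    have h2 := xiDeg_corner_le_two D hξh (yc_spec D j)
    rw [l1_xiDeg_eq, Finset.filter_true_of_mem fun j _ => hall j, Finset.card_univ, Fintype.card_fin] at h2
    omega
  · -- F = s ∈ {v, oppFace v i} has the erased bond among its sides
    rw [Finset.mem_insert, Finset.mem_singleton] at hs
    rcases hs with rfl | rfl
    · exact (Finset.mem_erase.1 (hsub (hall i))).1 rfl
    · exact (Finset.mem_erase.1 (hsub (hall (oppIdx v i)))).1 (side_oppFace_oppIdx v i)

end Blocks

section ThreeMarks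

variable {D : TriMarkedDomain 3}

/-- Auxiliary. [folklore] -/
private theorem fin3_cases_bv (v j : Fin 3) : j = v ∨ j = v + 1 ∨ j = v + 2 := by revert v j; decide

/-- the two `H_G`-darts at the corner face `y₂` have stretch indices `1` and `2`: the corner `y₂` is not a face of an edge whose boundary
dart lies on the stretch `A₀`. Formally: if `side v i = s(g, o)` with `(g, o)` a boundary dart of stretch index `0`, then `oppFace v i ≠ y₂`
and `v ≠ y₂`. [cite: KhristoforovSmirnov2021, §2 eq. (4) (arXiv v1 p. 5)] -/
theorem ne_yc_two_of_stretch_zero {F : HexVertex} {j : Fin 3} {g o : Site 2} (he : side F j = s(g, o)) (hg : g ∈ D.verts)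
    (ho : o ∉ D.verts) (hst : D.stretchIdx₃ (D.dpos (g, o)) = 0) : F ≠ yc D 2 := by
  intro hF
  subst hF
  obtain ⟨w, h0, h1, h2, hor⟩ := isCornerFace_typeII D (yc_spec D 2)
  -- the bond s(g,o) is a side of y₂ containing its only G-site, so (g,o) is predDart 2 or markDart 2
  have hg' : g ∈ hexFaceVertices (yc D 2) := by
    have : g ∈ (side (yc D 2) j : Sym2 (Site 2)) := by rw [he]; exact Sym2.mem_mk_left g o
    unfold side at this
    rcases Sym2.mem_iff.1 this with e | e <;> rw [e] <;> exact faceVertex_mem _ _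
  have hgw : g = faceVertex (yc D 2) w := by
    obtain ⟨a, ha⟩ := mem_hexFaceVertices_iff_faceVertex.1 hg'
    rcases fin3_cases_bv w a with e | e | e
    · rw [ha, e]
    · exact absurd (e ▸ ha ▸ hg) h1
    · exact absurd (e ▸ ha ▸ hg) h2
  have ho' : o ∈ hexFaceVertices (yc D 2) := by
    have : o ∈ (side (yc D 2) j : Sym2 (Site 2)) := by rw [he]; exact Sym2.mem_mk_right g o
    unfold side at this
    rcases Sym2.mem_iff.1 this with e | e <;> rw [e] <;> exact faceVertex_mem _ _
  have hgo : g ≠ o := fun e => ho (e ▸ hg)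
  obtain ⟨b, hb⟩ := mem_hexFaceVertices_iff_faceVertex.1 ho'
  have hb' : b = w + 1 ∨ b = w + 2 := by
    rcases fin3_cases_bv w b with e | e | e
    · exact absurd (hgw.trans (e ▸ hb).symm) hgo
    · exact Or.inl e
    · exact Or.inr e
  -- g = x_w = v₂ (the marked site), o = x_b with b ∈ {w+1, w+2}: the dart (g, o) is predDart 2 or markDart 2
  have hg2 : g = D.markSite 2 := hgw.trans h0
  have hdart : (g, o) = predDart D 2 ∨ (g, o) = D.markDart 2 := by
    rcases hor with ⟨hp1, hm2⟩ | ⟨hm1, hp2⟩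
    · rcases hb' with rfl | rfl
      · exact Or.inl (Prod.ext (by rw [predDart_fst]; exact hg2) (by rw [hb]; exact hp1))
      · exact Or.inr (Prod.ext hg2 (by rw [hb]; exact hm2))
    · rcases hb' with rfl | rfl
      · exact Or.inr (Prod.ext hg2 (by rw [hb]; exact hm1))
      · exact Or.inl (Prod.ext (by rw [predDart_fst]; exact hg2) (by rw [hb]; exact hp2))
  rcases hdart with hdd | hdd
  · rw [hdd, stretchIdx₃_predDart] at hst
    exact absurd hst (by decide)
  · rw [hdd, stretchIdx₃_markDart] at hst
    exact absurd hst (by decide)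


/-- the frame-`A₀` colour of the stretch `A₀` is white (`false`); of `A₁`, `A₂` black. [folklore] -/
private theorem bcolOf₃_zero : TriMarkedDomain.bcolOf₃ 0 = false ∧ TriMarkedDomain.bcolOf₃ 1 = true ∧ TriMarkedDomain.bcolOf₃ 2 = true := by
  decide

/-- ★ **GENERIC CASE of the boundary-value law (frame `A₀`)**: at an edge of `H_G` whose bond is the boundary dart `(g, o)` of the stretch
`A₀` (colour change of the frame at the marks `0` and `1`), an endpoint `s ∈ {v, oppFace v i}` that is not a corner face is NEVER linked to the
opposite corner `y₂` in a configuration of the XOR space — the strand from `s` would be monochromatic (its faces have no side in the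
realised reduced configuration), white at `z` (it reads the colour of `A₀` across the non-bicoloured bond `s(g,o)`) and black at `y₂` (it
reads `A₁`/`A₂`). [cite: KhristoforovSmirnov2021, §2 eq. (4) (arXiv v1 p. 5: on `∂_jΩ` the pattern `[z ↔ u_j]` is absent)] -/
theorem not_reachable_yc_two {v : HexVertex} (hv : AllSides D v) {i : Fin 3} {s : HexVertex}
    (hs : s ∈ ({v, oppFace v i} : Finset HexVertex)) (hsc : s ∉ corners D) {g o : Site 2} (he : side v i = s(g, o))
    (hg : g ∈ D.verts) (ho : o ∉ D.verts) (hst : D.stretchIdx₃ (D.dpos (g, o)) = 0)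
    {ξ : Finset (Sym2 (Site 2))} (hξ : ξ ∈ TXb D v i s) : ¬ (sideGraph ξ).Reachable s (yc D 2) := by
  classical
  intro hR
  have hdeg := xiDeg_le_two_of_mem_TXb D i hs hξ
  have hξ0 := hξ
  rw [mem_TXb_iff] at hξ0
  obtain ⟨hsub, hpar⟩ := hξ0
  have hξh : ξ ⊆ hBonds D := fun b hb => Finset.mem_of_mem_erase (hsub hb)
  have hside_not : side v i ∉ ξ := fun h => (Finset.mem_erase.1 (hsub h)).1 rfl
  -- the endpoints
  have hvT : v ∈ triFacesTouching D.verts := mem_touching_of_side_mem D (hv i)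
  have hoT : oppFace v i ∈ triFacesTouching D.verts :=
    mem_touching_of_side_mem D (j := oppIdx v i) (by rw [side_oppFace_oppIdx]; exact hv i)
  have hsT : s ∈ triFacesTouching D.verts := by
    rw [Finset.mem_insert, Finset.mem_singleton] at hs
    rcases hs with rfl | rfl
    · exact hvT
    · exact hoT
  have hs_odd : Odd (xiDeg ξ s) := (hpar s hsT).2 (by
    rw [Finset.mem_symmDiff, Finset.mem_singleton]; exact Or.inr ⟨rfl, hsc⟩)
  have hy2_ne_s : yc D 2 ≠ s := fun e => hsc (e ▸ (mem_corners D).2 ⟨2, rfl⟩)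
  have hy2_odd : Odd (xiDeg ξ (yc D 2)) := (hpar _ (yc_mem_touching D 2)).2 (by
    rw [Finset.mem_symmDiff, Finset.mem_singleton]; exact Or.inl ⟨(mem_corners D).2 ⟨2, rfl⟩, hy2_ne_s⟩)
  obtain ⟨-, huniq⟩ := odd_component D hξh hdeg hsT hs_odd
  -- the reduced configuration: sides off the component of s
  set ξ' : Finset (Sym2 (Site 2)) := ξ.filter fun e => ¬ ∃ F, (sideGraph ξ).Reachable s F ∧ ∃ j : Fin 3, e = side F j with hξ'
  obtain ⟨h0, h1, -⟩ := restrict_off_component D hξh s ξ' (fun e => by rw [hξ', Finset.mem_filter])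
  have hξ'h : ξ' ⊆ hBonds D := fun e he' => hξh (Finset.mem_filter.1 he').1
  have hξ'sub : ξ' ⊆ ξ := fun e he' => (Finset.mem_filter.1 he').1
  -- its odd faces are y₀ and y₁
  have hpar' : ParityIs D ξ' {yc D 0, yc D 1} := by
    intro F hF
    rw [Finset.mem_insert, Finset.mem_singleton]
    have hj3 : ∀ j : Fin 3, j = 0 ∨ j = 1 ∨ j = 2 := by decide
    by_cases hrF : (sideGraph ξ).Reachable s F
    · rw [h0 F hrF]
      constructor
      · intro h; exact absurd h (by decide)
      · intro hF01
        exfalso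
        have hFc : F ∈ corners D := by
          rcases hF01 with rfl | rfl
          · exact (mem_corners D).2 ⟨0, rfl⟩
          · exact (mem_corners D).2 ⟨1, rfl⟩
        have hFs : F ≠ s := fun e => hsc (e ▸ hFc)
        have hoddF : Odd (xiDeg ξ F) := (hpar _ hF).2 (by
          rw [Finset.mem_symmDiff, Finset.mem_singleton]; exact Or.inl ⟨hFc, hFs⟩)
        have hF2 : F = yc D 2 := huniq _ _ hrF hR hoddF hy2_odd hFs hy2_ne_s
        rcases hF01 with rfl | rfl
        · exact absurd (yc_injective D hF2) (by decide)
        · exact absurd (yc_injective D hF2) (by decide)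
    · rw [h1 F hrF, hpar F hF, Finset.mem_symmDiff, Finset.mem_singleton]
      have hFs : F ≠ s := fun e => hrF (e ▸ SimpleGraph.Reachable.refl _)
      have hF2 : F ≠ yc D 2 := fun e => hrF (e ▸ hR)
      constructor
      · rintro (⟨hc, -⟩ | ⟨e, -⟩)
        · obtain ⟨j, rfl⟩ := (mem_corners D).1 hc
          rcases hj3 j with rfl | rfl | rfl
          · exact Or.inl rfl
          · exact Or.inr rfl
          · exact absurd rfl hF2
        · exact absurd e hFs
      · rintro (rfl | rfl)
        · exact Or.inl ⟨(mem_corners D).2 ⟨0, rfl⟩, hFs⟩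
        · exact Or.inl ⟨(mem_corners D).2 ⟨1, rfl⟩, hFs⟩
  -- realise it by a colouring (frame A₀)
  obtain ⟨T, -, hT⟩ := xiOf₃_surj hξ'h hpar'
  set B : Set (Site 2) := ↑T with hBdef
  -- faces on the strand have no side in ξ' = ξ₃(B)
  have hns : ∀ a : HexVertex, (sideGraph ξ).Reachable s a → ∀ j : Fin 3, side a j ∉ xiOf₃ D B := by
    intro a ha j hmem
    rw [hT] at hmem
    have h00 := h0 a ha
    rw [l1_xiDeg_eq, Finset.card_eq_zero, Finset.filter_eq_empty_iff] at h00
    exact h00 (Finset.mem_univ j) hmem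
  -- monochromatic faces along the strand
  have mono : ∀ {a : HexVertex}, (sideGraph ξ).Reachable s a → ∀ {j j' : Fin 3}, j ≠ j' →
      faceVertex a j ∈ D.verts → faceVertex a j ∈ B → faceVertex a j' ∈ D.verts → faceVertex a j' ∈ B := by
    intro a ha j j' hjj' hj hjB hj'
    obtain ⟨m, hm⟩ := ht3_pair_eq_side a hjj'
    have hnot : s(faceVertex a j, faceVertex a j') ∉ xiOf₃ D B := by rw [hm]; exact hns a ha m
    have hadj : triGraph.Adj (faceVertex a j) (faceVertex a j') :=
      adj_of_mem_hexFaceVertices (faceVertex_mem a j) (faceVertex_mem a j') (fun e => hjj' (faceVertex_injective a e))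
    rw [mk_mem_xiOf₃_iff B hadj (Or.inl hj), bic₃_iff_of_mem_mem B hj hj'] at hnot
    by_contra hout
    exact hnot ⟨fun _ => hout, fun _ => hjB⟩
  -- BLACK propagates from y₂ back along the strand
  have key : ∀ a : HexVertex, Relation.ReflTransGen (sideGraph ξ).Adj a (yc D 2) →
      (sideGraph ξ).Reachable s a → ∀ w : Fin 3, faceVertex a w ∈ D.verts → faceVertex a w ∈ B := by
    intro a hab
    induction hab using Relation.ReflTransGen.head_induction_on with
    | refl =>
      intro hra w hw
      obtain ⟨w₀, hw0, hw1, hw2, hor⟩ := isCornerFace_typeII D (yc_spec D 2)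
      have hww : w = w₀ := by
        rcases fin3_cases_bv w₀ w with e | e | e
        · exact e
        · exact absurd (e ▸ hw) hw1
        · exact absurd (e ▸ hw) hw2
      subst hww
      have e1 : w + 2 + 1 = w := TriMarkedDomain.fin3_add_two_add_one w
      have e2 : w + 2 + 2 = w + 1 := TriMarkedDomain.fin3_add_two_add_two w
      have hsd : s(faceVertex (yc D 2) w, faceVertex (yc D 2) (w + 1)) ∉ xiOf₃ D B := by
        have := hns _ hra (w + 2)
        unfold side at this
        rwa [e1, e2] at this
      have hadj : triGraph.Adj (faceVertex (yc D 2) w) (faceVertex (yc D 2) (w + 1)) := TriMarkedDomain.adj_faceVertex_succ _ w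
      rw [mk_mem_xiOf₃_iff B hadj (Or.inl hw), bic₃_iff_of_mem_not_mem B hw hw1] at hsd
      have hcol : D.bdryCol₃ (D.dpos (faceVertex (yc D 2) w, faceVertex (yc D 2) (w + 1))) = true := by
        obtain ⟨-, c1, c2⟩ := bcolOf₃_zero
        unfold TriMarkedDomain.bdryCol₃
        rcases hor with ⟨hp1, -⟩ | ⟨hm1, -⟩
        · have hd : (faceVertex (yc D 2) w, faceVertex (yc D 2) (w + 1)) = predDart D 2 :=
            Prod.ext (by rw [predDart_fst]; exact hw0) hp1
          rw [hd, stretchIdx₃_predDart]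
          exact c1
        · have hd : (faceVertex (yc D 2) w, faceVertex (yc D 2) (w + 1)) = D.markDart 2 := Prod.ext hw0 hm1
          rw [hd, stretchIdx₃_markDart, c2]
      rw [hcol] at hsd
      by_contra hout
      exact hsd ⟨fun hin => absurd hin hout, fun h => absurd h (by decide)⟩
    | head hac hcb ih =>
      rename_i a c
      intro hra w hw
      have hrc : (sideGraph ξ).Reachable s c := hra.trans hac.reachable
      obtain ⟨j, hcj, hmem⟩ := hac
      obtain ⟨x, y, hexy, hxG, -⟩ := exists_rep_of_mem_hBonds D (hξh hmem)
      have hx : x = faceVertex a (j + 1) ∨ x = faceVertex a (j + 2) := by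
        unfold side at hexy
        rcases Sym2.eq_iff.1 hexy with ⟨hx1, -⟩ | ⟨-, hx2⟩
        · exact Or.inl hx1.symm
        · exact Or.inr hx2.symm
      obtain ⟨i₁, hi₁⟩ : ∃ i₁ : Fin 3, x = faceVertex a i₁ := by
        rcases hx with h | h
        · exact ⟨j + 1, h⟩
        · exact ⟨j + 2, h⟩
      have hxB : x ∈ B := by
        rcases hx with h | h
        · have hc' : x = faceVertex c (oppIdx a j + 2) := by rw [hcj, faceVertex_oppFace_succ_succ]; exact h
          have := ih hrc (oppIdx a j + 2) (hc' ▸ hxG)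
          rwa [← hc'] at this
        · have hc' : x = faceVertex c (oppIdx a j + 1) := by rw [hcj, faceVertex_oppFace_succ]; exact h
          have := ih hrc (oppIdx a j + 1) (hc' ▸ hxG)
          rwa [← hc'] at this
      by_cases hwi : w = i₁
      · rw [hwi, ← hi₁]; exact hxB
      · exact mono hra (Ne.symm hwi) (hi₁ ▸ hxG) (hi₁ ▸ hxB) hw
  -- at the start: g is a G-site of s, hence black; but the bond s(g,o) is not bicoloured and o reads the colour of A₀ (white)
  have hgs : g ∈ hexFaceVertices s := by
    have hgv : g ∈ (side v i : Sym2 (Site 2)) := by rw [he]; exact Sym2.mem_mk_left g o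
    rw [Finset.mem_insert, Finset.mem_singleton] at hs
    rcases hs with rfl | rfl
    · unfold side at hgv
      rcases Sym2.mem_iff.1 hgv with e | e <;> rw [e] <;> exact faceVertex_mem _ _
    · rw [← side_oppFace_oppIdx v i] at hgv
      unfold side at hgv
      rcases Sym2.mem_iff.1 hgv with e | e <;> rw [e] <;> exact faceVertex_mem _ _
  obtain ⟨w, hw⟩ := mem_hexFaceVertices_iff_faceVertex.1 hgs
  have hgB : g ∈ B := by
    have hR' : Relation.ReflTransGen (sideGraph ξ).Adj s (yc D 2) := (SimpleGraph.reachable_iff_reflTransGen _ _).1 hR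
    have := key s hR' (SimpleGraph.Reachable.refl _) w (hw ▸ hg)
    rwa [← hw] at this
  have hgo_adj : triGraph.Adj g o := by
    have hsub' : (side v i : Sym2 (Site 2)) ∈ hBonds D := hv i
    obtain ⟨a, b, hab, -, hadj⟩ := exists_rep_of_mem_hBonds D hsub'
    rw [he] at hab
    rcases Sym2.eq_iff.1 hab with ⟨rfl, rfl⟩ | ⟨rfl, rfl⟩
    · exact hadj
    · exact hadj.symm
  have hnot : s(g, o) ∉ xiOf₃ D B := by
    rw [hT]; exact fun h => hside_not (he ▸ hξ'sub h)
  rw [mk_mem_xiOf₃_iff B hgo_adj (Or.inl hg), bic₃_iff_of_mem_not_mem B hg ho] at hnot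
  have hcol0 : D.bdryCol₃ (D.dpos (g, o)) = false := by
    unfold TriMarkedDomain.bdryCol₃; rw [hst]; exact bcolOf₃_zero.1
  rw [hcol0] at hnot
  exact hnot ⟨fun _ => rfl, fun _ => hgB⟩

/-- **the «z adjacent to a mark» sub-case**: if the endpoint `s ∈ {v, oppFace v i}` is itself a corner face, it has NO side in a
configuration of `TXb D v i s` (its parity there is even, at most two of its sides are `H_G`-bonds and one of them is the excluded bond), so
it is linked to nothing but itself. [cite: KhristoforovSmirnov2021, §2 eq. (4) (arXiv v1 p. 5)] -/
theorem not_reachable_of_corner_end {nm : ℕ} {D : TriMarkedDomain nm} {v : HexVertex} (hv : AllSides D v) (i : Fin 3) {s : HexVertex}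
    (hs : s ∈ ({v, oppFace v i} : Finset HexVertex)) (hsc : s ∈ corners D) {ξ : Finset (Sym2 (Site 2))} (hξ : ξ ∈ TXb D v i s)
    {Y : HexVertex} (hY : Y ≠ s) : ¬ (sideGraph ξ).Reachable s Y := by
  classical
  rw [mem_TXb_iff] at hξ
  obtain ⟨hsub, hpar⟩ := hξ
  have hξh : ξ ⊆ hBonds D := fun b hb => Finset.mem_of_mem_erase (hsub hb)
  obtain ⟨a, rfl⟩ := (mem_corners D).1 hsc
  -- the excluded bond `side v i` is a side `j₀` of the corner, and some side `w` of the corner is not an `H_G`-bond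
  obtain ⟨j₀, hj₀⟩ : ∃ j : Fin 3, side (yc D a) j = side v i := by
    rw [Finset.mem_insert, Finset.mem_singleton] at hs
    rcases hs with e | e
    · exact ⟨i, by rw [e]⟩
    · exact ⟨oppIdx v i, by rw [e, side_oppFace_oppIdx]⟩
  obtain ⟨w, hw⟩ := exists_side_not_mem_hBonds_of_corner D (yc_spec D a)
  have hjw : j₀ ≠ w := fun e => hw (by rw [← e, hj₀]; exact hv i)
  -- so the sides of the corner lying in ξ are among the single remaining index
  have hfilter : ((Finset.univ : Finset (Fin 3)).filter fun j => side (yc D a) j ∈ ξ) ⊆ (Finset.univ.erase j₀).erase w := by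
    intro j hj
    rw [Finset.mem_filter] at hj
    rw [Finset.mem_erase, Finset.mem_erase]
    refine ⟨fun e => hw (e ▸ hξh hj.2), fun e => ?_, Finset.mem_univ _⟩
    rw [e, hj₀] at hj
    exact (Finset.mem_erase.1 (hsub hj.2)).1 rfl
  have hcard : #((Finset.univ.erase j₀).erase w) = 1 := by
    rw [Finset.card_erase_of_mem (by rw [Finset.mem_erase]; exact ⟨hjw.symm, Finset.mem_univ _⟩),
      Finset.card_erase_of_mem (Finset.mem_univ _), Finset.card_univ, Fintype.card_fin]
  have hle1 : xiDeg ξ (yc D a) ≤ 1 := by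
    rw [l1_xiDeg_eq]; exact (Finset.card_le_card hfilter).trans hcard.le
  have heven : ¬ Odd (xiDeg ξ (yc D a)) := fun h => by
    have := (hpar _ (yc_mem_touching D a)).1 h
    rw [Finset.mem_symmDiff, Finset.mem_singleton] at this
    rcases this with ⟨-, hne⟩ | ⟨-, hnc⟩
    · exact hne rfl
    · exact hnc hsc
  have hzero : xiDeg ξ (yc D a) = 0 := by
    rcases Nat.le_one_iff_eq_zero_or_eq_one.1 hle1 with h | h
    · exact h
    · exact absurd (h ▸ odd_one) heven
  -- an isolated face reaches only itself
  intro hR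
  rw [SimpleGraph.reachable_iff_reflTransGen] at hR
  rcases Relation.ReflTransGen.cases_head hR with e | ⟨c, hadj, -⟩
  · exact hY e.symm
  · obtain ⟨j, -, hj⟩ := hadj
    rw [l1_xiDeg_eq, Finset.card_eq_zero, Finset.filter_eq_empty_iff] at hzero
    exact hzero (Finset.mem_univ j) hj

/-- ★ **THE BOUNDARY-VALUE LAW, frame `A₀` (Khristoforov–Smirnov eq. (4) at `k = 3`, loop side)**: at a mid-edge `z` of the
boundary arc `A₀` (the bond `side v i = s(g,o)`, `(g,o)` a boundary dart of stretch index `0`, read at a face `v` with three `H_G`-sides)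
NO configuration links `z` to the opposite corner `u₂`: `N₂(z) = 0`, i.e. `H₂(z) = 0`. [cite: KhristoforovSmirnov2021, §2 eq. (4) (arXiv v1 p. 5)] -/
theorem classCount_two_eq_zero_of_stretch_zero {v : HexVertex} (hv : AllSides D v) {i : Fin 3} {g o : Site 2}
    (he : side v i = s(g, o)) (hg : g ∈ D.verts) (ho : o ∉ D.verts) (hst : D.stretchIdx₃ (D.dpos (g, o)) = 0) :
    classCount D v i 2 = 0 := by
  classical
  have key : ∀ s ∈ ({v, oppFace v i} : Finset HexVertex), ∀ ξ ∈ TXb D v i s,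
      ¬ InClassX D (faceVertex v (i + 1)) (faceVertex v (i + 2)) s 2 ξ := by
    intro s hs ξ hξ hcl
    rw [hbK_inClassX_iff] at hcl
    obtain ⟨-, hR⟩ := hcl
    by_cases hsc : s ∈ corners D
    · have hs2 : yc D 2 ≠ s := by
        rw [Finset.mem_insert, Finset.mem_singleton] at hs
        rcases hs with rfl | rfl
        · exact (ne_yc_two_of_stretch_zero (j := i) he hg ho hst).symm
        · exact (ne_yc_two_of_stretch_zero (j := oppIdx v i) (by rw [side_oppFace_oppIdx]; exact he) hg ho hst).symm
      exact not_reachable_of_corner_end hv i hs hsc hξ hs2 hR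
    · exact not_reachable_yc_two hv hs hsc he hg ho hst hξ hR
  unfold classCount
  rw [Finset.card_eq_zero.2 (Finset.filter_eq_empty_iff.2 fun ξ hξ => key v (by simp) ξ hξ),
    Finset.card_eq_zero.2 (Finset.filter_eq_empty_iff.2 fun ξ hξ => key (oppFace v i) (by simp) ξ hξ)]

/-- … hence **`H₂(z) = 0` on `A₀`**. [cite: KhristoforovSmirnov2021, §2 eq. (4) (arXiv v1 p. 5)] -/
theorem hobs_two_eq_zero_of_stretch_zero {v : HexVertex} (hv : AllSides D v) {i : Fin 3} {g o : Site 2}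
    (he : side v i = s(g, o)) (hg : g ∈ D.verts) (ho : o ∉ D.verts) (hst : D.stretchIdx₃ (D.dpos (g, o)) = 0) :
    Hobs D v i 2 = 0 := by
  unfold Hobs
  rw [classCount_two_eq_zero_of_stretch_zero hv he hg ho hst, Nat.cast_zero, zero_div]

/-- on `A₀`: **`H₀(z) + H₁(z) = 1`**. [cite: KhristoforovSmirnov2021, §2 eq. (4) (arXiv v1 p. 5)] -/
theorem hobs_zero_add_hobs_one_of_stretch_zero {v : HexVertex} (hv : AllSides D v) {i : Fin 3} {g o : Site 2}
    (he : side v i = s(g, o)) (hg : g ∈ D.verts) (ho : o ∉ D.verts) (hst : D.stretchIdx₃ (D.dpos (g, o)) = 0) :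
    Hobs D v i 0 + Hobs D v i 1 = 1 := by
  have h := sum_hobs_eq_one D hv i
  rw [Fin.sum_univ_three, hobs_two_eq_zero_of_stretch_zero hv he hg ho hst, add_zero] at h
  exact h

/-- ★ on `A₀`: **`F(z) = H₀(z) + τ·H₁(z)`** with `H₀ + H₁ = 1` — `F(z)` lies on the segment `[1, τ] = [τ³, τ¹]` of Khristoforov–Smirnov's
eq. (4) (`j = 2`: `∂₂Ω = A₀`, `F(∂₂Ω) ⊂ [τ¹, τ³]`). [cite: KhristoforovSmirnov2021, §2 eq. (4) (arXiv v1 p. 5)] -/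
theorem fobs_of_stretch_zero {v : HexVertex} (hv : AllSides D v) {i : Fin 3} {g o : Site 2}
    (he : side v i = s(g, o)) (hg : g ∈ D.verts) (ho : o ∉ D.verts) (hst : D.stretchIdx₃ (D.dpos (g, o)) = 0) :
    Fobs D v i = (Hobs D v i 0 : ℂ) + tau * (Hobs D v i 1 : ℂ) := by
  unfold Fobs
  rw [Fin.sum_univ_three, hobs_two_eq_zero_of_stretch_zero hv he hg ho hst]
  push_cast
  simp only [Fin.val_zero, Fin.val_one, pow_zero, pow_one, one_mul, mul_zero, add_zero]

end ThreeMarks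

end Literature.Probability.Percolation.MarkedLoops
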